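/-
Origin: expansion seat `prover-pub-hodgecm-mc-sinst-1-g11-0`, handover #1263 2026-08-21T02:52Z md5 968682777642 (320 l.; NEW additive leaf, ns HodgeCM.Model.ThetaAdelicSide, twelve defs, no theorems: thetaDistDatum{Zero,One,Two,Three}OfT … η hη hηc ν hν hνc h₁W AT … : ThetaDistDatum (archSideOfT V c … η hη hηc ν hν hνc h₁W AT) hV k (R1 pin; η₀/η₁ := etaT₀/etaT₁ η ν, η₂/η₃ default); thetaDistDatum{Zero,One,Two,Three}OfT' … η hη hηc ν hν hνc ν' hν' hν'c h₁W AT' … : ThetaDistDatum (archSideOfT' V c … ) hV k (THE R2 PIN OF RECORD SROGT'C — η₀/η₁ := etaT₀/etaT₁ η ν, η₂/η₃ := etaT₂/etaT₃ η ν'; archSideOfT'_P_ω rfl; continuous_etaT_k); thetaDistDatum{Zero,One,Two,Three}OfChar (η₀ η₁ η₂ η₃ hmaj hrat AC) (hη_kc) … : ThetaDistDatum (archSideOfChar V c … η₀ η₁ η₂ η₃ hmaj hrat AC) hV k (four-character side; archSideOfChar_P_ω rfl); NAMES for audit: none (defs only)) (`HOME/mc/pub-hodgecm-mc-sinst-1-g11/stage70/HodgeCM/Model/AdelicThetaDistributionOfGPins.lean`,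 md5 968682777642, 320 lines);
landed by the second packager p2 gen 17 (p2-g17) in gate run 70 as `HodgeCM/Model/AdelicThetaDistributionOfGPins.lean` (verbatim).
-/
/-
Copyright (c) 2026 the pub-hodgecm formalisation cell (harness21).  New file, not vendored.
Origin: session prover-pub-hodgecm-mc-sinst-1-g11-0 (unit pub-hodgecm-mc-sinst-1-g11, S-INSTANCE CONSTRUCTOR gen 11; the honest (J4) product
Weil datum AT THE TWISTED PINS — instances of the pin-agnostic G-datum of `Model/AdelicThetaDistributionOfG` at period-1's `archSideOfT`
(R1), `archSideOfT'` (R2 = THE PIN OF RECORD `SInstance.SROGT'C`, lead 1-g84 ROUTING WORD 2026-08-21T02:34:03Z ∕ 02:38:29Z) and the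
four-character side `archSideOfChar`), 2026-08-21.
Intended final place: `HodgeCM/Model/AdelicThetaDistributionOfGPins.lean` (NEW additive model-layer leaf; imports sinst-1
`Model/AdelicThetaDistributionOfG`, period-1 `Model/ArchSideOfTwist34`, `Model/ArchSideOfChar`; nothing imports it; drop alone).
-/
import Summits.HodgeConjecture.HodgeCM.Model.AdelicThetaDistributionOfG
import Summits.HodgeConjecture.HodgeCM.Model.ArchSideOfTwist34
import Summits.HodgeConjecture.HodgeCM.Model.ArchSideOfChar

set_option autoImplicit false

/-!
# The honest (J4) datum at the twisted pins (R1 `archSideOfT`, R2 `archSideOfT'`, four-character `archSideOfChar`)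

* `thetaDistDatum_kOfT` : the instances at the ν-carrying (R1) pin `archSideOfT … η ν …` (`η₀ := etaT₀ η ν`, `η₁ := etaT₁ η ν`);
* **`thetaDistDatum_kOfT'`** : the instances at the DOUBLY twisted (R2) side `archSideOfT' … η ν ν' …` (`Model/ArchSideOfTwist34`;
  `η₀∕η₁ := etaT₀∕etaT₁ η ν`, `η₂∕η₃ := etaT₂∕etaT₃ η ν'`; `archSideOfT'_P_ω`, `rfl`) — THE PIN OF RECORD `SInstance.SROGT'C …` for the
  discharge of `hΘ` ∕ `hJ` (lead 1-g84 ROUTING WORD 2026-08-21T02:34:03Z + precision 02:38:29Z);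
* **`thetaDistDatum_kOfChar`** : the instances at the FOUR-CHARACTER side `archSideOfChar … η₀ η₁ η₂ η₃ hmaj hrat A` (`Model/ArchSideOfChar`;
  `archSideOfChar_P_ω`, `rfl`) — the side of the R2 pin of record `SInstance.SROGT'C …` (lead 1-g84 ROUTING WORD 2026-08-21T02:34:03Z:
  `archSideOfT'` = `archSideOfChar` by `rfl`, carch #CA57), slots 0∕1 AND 2∕3 twisted.
All by `thetaDistDatum_kOfG … rfl … rfl …` (the pins' `P_ω` read-backs are `rfl`).  KERNEL only: twelve `def`s; 0 records, 0 `def … : Prop`,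
nothing cited.
-/

noncomputable section

open NumberField NumberField.mixedEmbedding IsDedekindDomain MulAction
open scoped Matrix TensorProduct Classical SchwartzMap
open Literature.NumberTheory.Automorphic Literature.NumberTheory.Weil1964
open Literature.NumberTheory.GelbartRogawski1991 Literature.NumberTheory.GelbartRogawski1991.UnitaryDualPair
open Literature.Geometry.ComplexHyperbolic.BallModel (U21 x₀)
open Literature.AlgebraicGeometry.ShimuraVarieties
open HodgeCM.Adelic HodgeCM.PerL34 HodgeCM.Model.ArchSideTerm HodgeCM.Model.ThetaDistFin

namespace HodgeCM.Model
namespace ThetaAdelicSide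

variable {L : CMField} {ι₁ : L →+* ℂ} (V : HermSpace3 L ι₁) (c : SeesawCtx L)
  (hGR : (cmSplittingDatum (L : Type) finProdFinEquiv (frameD V) (frameD_real V) (frameD_ne V) (dW c.D) (dW_real c.D)
    (dW_ne c.D)).CompatibleSplitting)
  (hGR₀ : (cmSplittingDatum (L : Type) (e₁) (frameD V) (frameD_real V) (frameD_ne V) (lineVec (L : Type) (dW c.D 0))
    (fun _ => dW_real c.D 0) (fun _ => dW_ne c.D 0)).CompatibleSplitting)
  (hGR₁ : (cmSplittingDatum (L : Type) (e₁) (frameD V) (frameD_real V) (frameD_ne V) (lineVec (L : Type) (dW c.D 1))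
    (fun _ => dW_real c.D 1) (fun _ => dW_ne c.D 1)).CompatibleSplitting)
  (hGR₂ : (cmSplittingDatum (L : Type) (e₁) (frameD V) (frameD_real V) (frameD_ne V) (lineVec (L : Type) (dW' c.D 0))
    (fun _ => dW'_real c.D 0) (fun _ => dW'_ne c.D 0)).CompatibleSplitting)
  (hGR₃ : (cmSplittingDatum (L : Type) (e₁) (frameD V) (frameD_real V) (frameD_ne V) (lineVec (L : Type) (dW' c.D 1))
    (fun _ => dW'_real c.D 1) (fun _ => dW'_ne c.D 1)).CompatibleSplitting)
  (h₁W : (∀ j, 0 < (ι₁ (dW c.D j)).re) ∨ ∀ j, (ι₁ (dW c.D j)).re < 0)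
  (hV : IsAnisotropic L V.Hm)

section TwistedPin

variable (η : CMAdelic (L : Type) (frameD V) × CMAdelic (L : Type) (dW c.D) →* ℂˣ)
  (hη : ∀ γU ∈ CMRat (L : Type) (frameD V), ∀ γ ∈ CMRat (L : Type) (dW c.D), η (γU, γ) = 1)
  (hηc : Continuous fun p => ((η p : ℂˣ) : ℂ))
  (ν : CMAdelic (L : Type) (frameD V) →* ℂˣ)
  (hν : ∀ γU ∈ CMRat (L : Type) (frameD V), ν γU = 1)
  (hνc : Continuous fun v => ((ν v : ℂˣ) : ℂ))
  (AT : ∀ k : Fin 4, ArchLineInput V (lineRepT V c.D hGR hGR₀ hGR₁ hGR₂ hGR₃ η ν k))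

/-- **THE HONEST (J4) DATUM OF SLOT 0 AT THE ν-CARRYING (R1) PIN `archSideOfT …`** (the pin under `SInstance.SROGT …` of the END-STATE
skeletons): the G-datum with `η₀ := etaT₀ η ν`, `η₁ := etaT₁ η ν`, `η₂ := eta₂ η`, `η₃ := eta₃ η` (`archSideOfT_P_ω`, `rfl`). -/
def thetaDistDatumZeroOfT (Φarch : Module.Dual ℂ (Fin 2 → ℂ) →ₗ[ℂ] 𝓢((Fin 3 → mixedSpace (↥(maximalRealSubfield L))), ℂ))
    (harm : ∀ (u : ↥(stabilizer U21 x₀)) (ℓ : Module.Dual ℂ (Fin 2 → ℂ)),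
      lineOmega_zero V c.D hGR hGR₀ hGR₁ (etaT₀ V c.D η ν) (u : U21) (Φarch ℓ) =
        Φarch ((BallForms.isPullbackCocycle_cotangentCocycle.weightOf x₀).dual u ℓ))
    (hdef : ∀ a : UnitaryGroup.arch (↥(maximalRealSubfield L)) L (IsCMField.complexConj L) 3 V.Hm,
      UnitaryGroup.archAt (↥(maximalRealSubfield L)) L (IsCMField.complexConj L) 3 V.Hm (UnitaryGroup.cmPlace (L : Type) ι₁)
          (NumberField.complexConj_smul_infinitePlace (L : Type) _) (IsCMField.complexConj_ne_one (L : Type)) a = 1 →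
      ∀ (ℓ : Module.Dual ℂ (Fin 2 → ℂ)) (Φf : FinSB (↥(maximalRealSubfield L)) (Fin 3)),
        lineRepOf V c.D hGR hGR₀ hGR₁ hGR₂ hGR₃ (etaT₀ V c.D η ν) (etaT₁ V c.D η ν) (eta₂ V c.D η) (eta₃ V c.D η) 0
            (HodgeCM.Adelic.regimeEquiv L V.Hm hV
              (UnitaryGroup.archToAdelic (↥(maximalRealSubfield L)) L (IsCMField.complexConj L) 3 V.Hm a), 1)
            (piSchwartzBruhatEquiv (↥(maximalRealSubfield L)) (Fin 3) (Φarch ℓ ⊗ₜ[ℂ] Φf)) =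
          piSchwartzBruhatEquiv (↥(maximalRealSubfield L)) (Fin 3) (Φarch ℓ ⊗ₜ[ℂ] Φf)) :
    ThetaDistDatum (archSideOfT V c hGR hGR₀ hGR₁ hGR₂ hGR₃ η hη hηc ν hν hνc h₁W AT) hV 0 :=
  thetaDistDatumZeroOfG V c _ hGR hGR₀ hGR₁ hGR₂ hGR₃ (etaT₀ V c.D η ν) (etaT₁ V c.D η ν) (eta₂ V c.D η) (eta₃ V c.D η) rfl h₁W hV rfl
    (continuous_etaT₀ V c.D η ν hηc hνc) Φarch harm hdef

/-- **slot 1 at the ν-carrying pin.** -/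
def thetaDistDatumOneOfT (Φarch : Module.Dual ℂ (Fin 2 → ℂ) →ₗ[ℂ] 𝓢((Fin 3 → mixedSpace (↥(maximalRealSubfield L))), ℂ))
    (harm : ∀ (u : ↥(stabilizer U21 x₀)) (ℓ : Module.Dual ℂ (Fin 2 → ℂ)),
      lineOmega_one V c.D hGR hGR₀ hGR₁ (etaT₁ V c.D η ν) (u : U21) (Φarch ℓ) =
        Φarch ((BallForms.isPullbackCocycle_cotangentCocycle.weightOf x₀).dual u ℓ))
    (hdef : ∀ a : UnitaryGroup.arch (↥(maximalRealSubfield L)) L (IsCMField.complexConj L) 3 V.Hm,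
      UnitaryGroup.archAt (↥(maximalRealSubfield L)) L (IsCMField.complexConj L) 3 V.Hm (UnitaryGroup.cmPlace (L : Type) ι₁)
          (NumberField.complexConj_smul_infinitePlace (L : Type) _) (IsCMField.complexConj_ne_one (L : Type)) a = 1 →
      ∀ (ℓ : Module.Dual ℂ (Fin 2 → ℂ)) (Φf : FinSB (↥(maximalRealSubfield L)) (Fin 3)),
        lineRepOf V c.D hGR hGR₀ hGR₁ hGR₂ hGR₃ (etaT₀ V c.D η ν) (etaT₁ V c.D η ν) (eta₂ V c.D η) (eta₃ V c.D η) 1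
            (HodgeCM.Adelic.regimeEquiv L V.Hm hV
              (UnitaryGroup.archToAdelic (↥(maximalRealSubfield L)) L (IsCMField.complexConj L) 3 V.Hm a), 1)
            (piSchwartzBruhatEquiv (↥(maximalRealSubfield L)) (Fin 3) (Φarch ℓ ⊗ₜ[ℂ] Φf)) =
          piSchwartzBruhatEquiv (↥(maximalRealSubfield L)) (Fin 3) (Φarch ℓ ⊗ₜ[ℂ] Φf)) :
    ThetaDistDatum (archSideOfT V c hGR hGR₀ hGR₁ hGR₂ hGR₃ η hη hηc ν hν hνc h₁W AT) hV 1 :=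
  thetaDistDatumOneOfG V c _ hGR hGR₀ hGR₁ hGR₂ hGR₃ (etaT₀ V c.D η ν) (etaT₁ V c.D η ν) (eta₂ V c.D η) (eta₃ V c.D η) rfl hV rfl
    (continuous_etaT₁ V c.D η ν hηc hνc) Φarch harm hdef

/-- **slot 2 at the ν-carrying pin** (lines 2∕3 keep the default split). -/
def thetaDistDatumTwoOfT (Φarch : Module.Dual ℂ (Fin 2 → ℂ) →ₗ[ℂ] 𝓢((Fin 3 → mixedSpace (↥(maximalRealSubfield L))), ℂ))
    (harm : ∀ (u : ↥(stabilizer U21 x₀)) (ℓ : Module.Dual ℂ (Fin 2 → ℂ)),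
      lineOmega_two V c.D hGR hGR₂ hGR₃ (eta₂ V c.D η) (u : U21) (Φarch ℓ) =
        Φarch ((BallForms.isPullbackCocycle_cotangentCocycle.weightOf x₀).dual u ℓ))
    (hdef : ∀ a : UnitaryGroup.arch (↥(maximalRealSubfield L)) L (IsCMField.complexConj L) 3 V.Hm,
      UnitaryGroup.archAt (↥(maximalRealSubfield L)) L (IsCMField.complexConj L) 3 V.Hm (UnitaryGroup.cmPlace (L : Type) ι₁)
          (NumberField.complexConj_smul_infinitePlace (L : Type) _) (IsCMField.complexConj_ne_one (L : Type)) a = 1 →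
      ∀ (ℓ : Module.Dual ℂ (Fin 2 → ℂ)) (Φf : FinSB (↥(maximalRealSubfield L)) (Fin 3)),
        lineRepOf V c.D hGR hGR₀ hGR₁ hGR₂ hGR₃ (etaT₀ V c.D η ν) (etaT₁ V c.D η ν) (eta₂ V c.D η) (eta₃ V c.D η) 2
            (HodgeCM.Adelic.regimeEquiv L V.Hm hV
              (UnitaryGroup.archToAdelic (↥(maximalRealSubfield L)) L (IsCMField.complexConj L) 3 V.Hm a), 1)
            (piSchwartzBruhatEquiv (↥(maximalRealSubfield L)) (Fin 3) (Φarch ℓ ⊗ₜ[ℂ] Φf)) =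
          piSchwartzBruhatEquiv (↥(maximalRealSubfield L)) (Fin 3) (Φarch ℓ ⊗ₜ[ℂ] Φf)) :
    ThetaDistDatum (archSideOfT V c hGR hGR₀ hGR₁ hGR₂ hGR₃ η hη hηc ν hν hνc h₁W AT) hV 2 :=
  thetaDistDatumTwoOfG V c _ hGR hGR₀ hGR₁ hGR₂ hGR₃ (etaT₀ V c.D η ν) (etaT₁ V c.D η ν) (eta₂ V c.D η) (eta₃ V c.D η) rfl h₁W hV rfl
    (continuous_cmConjEta₀ (L : Type) (frameD V) (dW c.D) (dW' c.D) c.D.isoGL (isoGL_hg₀ c.D) η hηc) Φarch harm hdef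

/-- **slot 3 at the ν-carrying pin.** -/
def thetaDistDatumThreeOfT (Φarch : Module.Dual ℂ (Fin 2 → ℂ) →ₗ[ℂ] 𝓢((Fin 3 → mixedSpace (↥(maximalRealSubfield L))), ℂ))
    (harm : ∀ (u : ↥(stabilizer U21 x₀)) (ℓ : Module.Dual ℂ (Fin 2 → ℂ)),
      lineOmega_three V c.D hGR hGR₂ hGR₃ (eta₃ V c.D η) (u : U21) (Φarch ℓ) =
        Φarch ((BallForms.isPullbackCocycle_cotangentCocycle.weightOf x₀).dual u ℓ))
    (hdef : ∀ a : UnitaryGroup.arch (↥(maximalRealSubfield L)) L (IsCMField.complexConj L) 3 V.Hm,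
      UnitaryGroup.archAt (↥(maximalRealSubfield L)) L (IsCMField.complexConj L) 3 V.Hm (UnitaryGroup.cmPlace (L : Type) ι₁)
          (NumberField.complexConj_smul_infinitePlace (L : Type) _) (IsCMField.complexConj_ne_one (L : Type)) a = 1 →
      ∀ (ℓ : Module.Dual ℂ (Fin 2 → ℂ)) (Φf : FinSB (↥(maximalRealSubfield L)) (Fin 3)),
        lineRepOf V c.D hGR hGR₀ hGR₁ hGR₂ hGR₃ (etaT₀ V c.D η ν) (etaT₁ V c.D η ν) (eta₂ V c.D η) (eta₃ V c.D η) 3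
            (HodgeCM.Adelic.regimeEquiv L V.Hm hV
              (UnitaryGroup.archToAdelic (↥(maximalRealSubfield L)) L (IsCMField.complexConj L) 3 V.Hm a), 1)
            (piSchwartzBruhatEquiv (↥(maximalRealSubfield L)) (Fin 3) (Φarch ℓ ⊗ₜ[ℂ] Φf)) =
          piSchwartzBruhatEquiv (↥(maximalRealSubfield L)) (Fin 3) (Φarch ℓ ⊗ₜ[ℂ] Φf)) :
    ThetaDistDatum (archSideOfT V c hGR hGR₀ hGR₁ hGR₂ hGR₃ η hη hηc ν hν hνc h₁W AT) hV 3 :=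
  thetaDistDatumThreeOfG V c _ hGR hGR₀ hGR₁ hGR₂ hGR₃ (etaT₀ V c.D η ν) (etaT₁ V c.D η ν) (eta₂ V c.D η) (eta₃ V c.D η) rfl hV rfl
    (continuous_cmConjEta₁_comp_snd (L : Type) (frameD V) (dW c.D) (dW' c.D) c.D.isoGL (isoGL_hg₀ c.D) η hηc) Φarch harm hdef

end TwistedPin


section CharPin

variable (η₀ η₁ η₂ η₃ : CMAdelic (L : Type) (frameD V) × CMAdelicOne (L : Type) →* ℂˣ)
variable (hmaj : ∀ k : Fin 4, HasThetaMajorants fun (p : ↥(regimeSubgroup L V.Hm) × ↥(NumberField.relNormOneIdeles (↥(maximalRealSubfield L)) L))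
      (φ : piSchwartzBruhat (↥(maximalRealSubfield L)) (Fin 3)) => lineRepOf V c.D hGR hGR₀ hGR₁ hGR₂ hGR₃ η₀ η₁ η₂ η₃ k p φ)
  (hrat : ∀ k : Fin 4, ∀ γ ∈ (V.latticeModel printFact_unitaryCompact_holds).Γ,
      ∀ t ∈ NumberField.relNormOneRat (↥(maximalRealSubfield L)) L,
        lineRepOf V c.D hGR hGR₀ hGR₁ hGR₂ hGR₃ η₀ η₁ η₂ η₃ k (γ, t) ∈ thetaStabilizerEnd (↥(maximalRealSubfield L)) (Fin 3))
  (AC : ∀ k : Fin 4, ArchLineInput V (lineRepOf V c.D hGR hGR₀ hGR₁ hGR₂ hGR₃ η₀ η₁ η₂ η₃ k))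

/-- **THE HONEST (J4) DATUM OF SLOT 0 AT THE FOUR-CHARACTER SIDE `archSideOfChar … η₀ η₁ η₂ η₃ …`** — the side of the R2 pin of record
(`archSideOfT'` = `archSideOfChar` by `rfl`). -/
def thetaDistDatumZeroOfChar (hη₀c : Continuous fun p => ((η₀ p : ℂˣ) : ℂ))
    (Φarch : Module.Dual ℂ (Fin 2 → ℂ) →ₗ[ℂ] 𝓢((Fin 3 → mixedSpace (↥(maximalRealSubfield L))), ℂ))
    (harm : ∀ (u : ↥(stabilizer U21 x₀)) (ℓ : Module.Dual ℂ (Fin 2 → ℂ)),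
      lineOmega_zero V c.D hGR hGR₀ hGR₁ η₀ (u : U21) (Φarch ℓ) =
        Φarch ((BallForms.isPullbackCocycle_cotangentCocycle.weightOf x₀).dual u ℓ))
    (hdef : ∀ a : UnitaryGroup.arch (↥(maximalRealSubfield L)) L (IsCMField.complexConj L) 3 V.Hm,
      UnitaryGroup.archAt (↥(maximalRealSubfield L)) L (IsCMField.complexConj L) 3 V.Hm (UnitaryGroup.cmPlace (L : Type) ι₁)
          (NumberField.complexConj_smul_infinitePlace (L : Type) _) (IsCMField.complexConj_ne_one (L : Type)) a = 1 →
      ∀ (ℓ : Module.Dual ℂ (Fin 2 → ℂ)) (Φf : FinSB (↥(maximalRealSubfield L)) (Fin 3)),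
        lineRepOf V c.D hGR hGR₀ hGR₁ hGR₂ hGR₃ η₀ η₁ η₂ η₃ 0
            (HodgeCM.Adelic.regimeEquiv L V.Hm hV
              (UnitaryGroup.archToAdelic (↥(maximalRealSubfield L)) L (IsCMField.complexConj L) 3 V.Hm a), 1)
            (piSchwartzBruhatEquiv (↥(maximalRealSubfield L)) (Fin 3) (Φarch ℓ ⊗ₜ[ℂ] Φf)) =
          piSchwartzBruhatEquiv (↥(maximalRealSubfield L)) (Fin 3) (Φarch ℓ ⊗ₜ[ℂ] Φf)) :
    ThetaDistDatum (archSideOfChar V c hGR hGR₀ hGR₁ hGR₂ hGR₃ η₀ η₁ η₂ η₃ hmaj hrat AC) hV 0 :=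
  thetaDistDatumZeroOfG V c _ hGR hGR₀ hGR₁ hGR₂ hGR₃ η₀ η₁ η₂ η₃ rfl h₁W hV rfl hη₀c Φarch harm hdef

/-- **slot 1 at the four-character side.** -/
def thetaDistDatumOneOfChar (hη₁c : Continuous fun p => ((η₁ p : ℂˣ) : ℂ))
    (Φarch : Module.Dual ℂ (Fin 2 → ℂ) →ₗ[ℂ] 𝓢((Fin 3 → mixedSpace (↥(maximalRealSubfield L))), ℂ))
    (harm : ∀ (u : ↥(stabilizer U21 x₀)) (ℓ : Module.Dual ℂ (Fin 2 → ℂ)),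
      lineOmega_one V c.D hGR hGR₀ hGR₁ η₁ (u : U21) (Φarch ℓ) =
        Φarch ((BallForms.isPullbackCocycle_cotangentCocycle.weightOf x₀).dual u ℓ))
    (hdef : ∀ a : UnitaryGroup.arch (↥(maximalRealSubfield L)) L (IsCMField.complexConj L) 3 V.Hm,
      UnitaryGroup.archAt (↥(maximalRealSubfield L)) L (IsCMField.complexConj L) 3 V.Hm (UnitaryGroup.cmPlace (L : Type) ι₁)
          (NumberField.complexConj_smul_infinitePlace (L : Type) _) (IsCMField.complexConj_ne_one (L : Type)) a = 1 →
      ∀ (ℓ : Module.Dual ℂ (Fin 2 → ℂ)) (Φf : FinSB (↥(maximalRealSubfield L)) (Fin 3)),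
        lineRepOf V c.D hGR hGR₀ hGR₁ hGR₂ hGR₃ η₀ η₁ η₂ η₃ 1
            (HodgeCM.Adelic.regimeEquiv L V.Hm hV
              (UnitaryGroup.archToAdelic (↥(maximalRealSubfield L)) L (IsCMField.complexConj L) 3 V.Hm a), 1)
            (piSchwartzBruhatEquiv (↥(maximalRealSubfield L)) (Fin 3) (Φarch ℓ ⊗ₜ[ℂ] Φf)) =
          piSchwartzBruhatEquiv (↥(maximalRealSubfield L)) (Fin 3) (Φarch ℓ ⊗ₜ[ℂ] Φf)) :
    ThetaDistDatum (archSideOfChar V c hGR hGR₀ hGR₁ hGR₂ hGR₃ η₀ η₁ η₂ η₃ hmaj hrat AC) hV 1 :=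
  thetaDistDatumOneOfG V c _ hGR hGR₀ hGR₁ hGR₂ hGR₃ η₀ η₁ η₂ η₃ rfl hV rfl hη₁c Φarch harm hdef

/-- **slot 2 at the four-character side.** -/
def thetaDistDatumTwoOfChar (hη₂c : Continuous fun p => ((η₂ p : ℂˣ) : ℂ))
    (Φarch : Module.Dual ℂ (Fin 2 → ℂ) →ₗ[ℂ] 𝓢((Fin 3 → mixedSpace (↥(maximalRealSubfield L))), ℂ))
    (harm : ∀ (u : ↥(stabilizer U21 x₀)) (ℓ : Module.Dual ℂ (Fin 2 → ℂ)),
      lineOmega_two V c.D hGR hGR₂ hGR₃ η₂ (u : U21) (Φarch ℓ) =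
        Φarch ((BallForms.isPullbackCocycle_cotangentCocycle.weightOf x₀).dual u ℓ))
    (hdef : ∀ a : UnitaryGroup.arch (↥(maximalRealSubfield L)) L (IsCMField.complexConj L) 3 V.Hm,
      UnitaryGroup.archAt (↥(maximalRealSubfield L)) L (IsCMField.complexConj L) 3 V.Hm (UnitaryGroup.cmPlace (L : Type) ι₁)
          (NumberField.complexConj_smul_infinitePlace (L : Type) _) (IsCMField.complexConj_ne_one (L : Type)) a = 1 →
      ∀ (ℓ : Module.Dual ℂ (Fin 2 → ℂ)) (Φf : FinSB (↥(maximalRealSubfield L)) (Fin 3)),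
        lineRepOf V c.D hGR hGR₀ hGR₁ hGR₂ hGR₃ η₀ η₁ η₂ η₃ 2
            (HodgeCM.Adelic.regimeEquiv L V.Hm hV
              (UnitaryGroup.archToAdelic (↥(maximalRealSubfield L)) L (IsCMField.complexConj L) 3 V.Hm a), 1)
            (piSchwartzBruhatEquiv (↥(maximalRealSubfield L)) (Fin 3) (Φarch ℓ ⊗ₜ[ℂ] Φf)) =
          piSchwartzBruhatEquiv (↥(maximalRealSubfield L)) (Fin 3) (Φarch ℓ ⊗ₜ[ℂ] Φf)) :
    ThetaDistDatum (archSideOfChar V c hGR hGR₀ hGR₁ hGR₂ hGR₃ η₀ η₁ η₂ η₃ hmaj hrat AC) hV 2 :=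
  thetaDistDatumTwoOfG V c _ hGR hGR₀ hGR₁ hGR₂ hGR₃ η₀ η₁ η₂ η₃ rfl h₁W hV rfl hη₂c Φarch harm hdef

/-- **slot 3 at the four-character side.** -/
def thetaDistDatumThreeOfChar (hη₃c : Continuous fun p => ((η₃ p : ℂˣ) : ℂ))
    (Φarch : Module.Dual ℂ (Fin 2 → ℂ) →ₗ[ℂ] 𝓢((Fin 3 → mixedSpace (↥(maximalRealSubfield L))), ℂ))
    (harm : ∀ (u : ↥(stabilizer U21 x₀)) (ℓ : Module.Dual ℂ (Fin 2 → ℂ)),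
      lineOmega_three V c.D hGR hGR₂ hGR₃ η₃ (u : U21) (Φarch ℓ) =
        Φarch ((BallForms.isPullbackCocycle_cotangentCocycle.weightOf x₀).dual u ℓ))
    (hdef : ∀ a : UnitaryGroup.arch (↥(maximalRealSubfield L)) L (IsCMField.complexConj L) 3 V.Hm,
      UnitaryGroup.archAt (↥(maximalRealSubfield L)) L (IsCMField.complexConj L) 3 V.Hm (UnitaryGroup.cmPlace (L : Type) ι₁)
          (NumberField.complexConj_smul_infinitePlace (L : Type) _) (IsCMField.complexConj_ne_one (L : Type)) a = 1 →
      ∀ (ℓ : Module.Dual ℂ (Fin 2 → ℂ)) (Φf : FinSB (↥(maximalRealSubfield L)) (Fin 3)),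
        lineRepOf V c.D hGR hGR₀ hGR₁ hGR₂ hGR₃ η₀ η₁ η₂ η₃ 3
            (HodgeCM.Adelic.regimeEquiv L V.Hm hV
              (UnitaryGroup.archToAdelic (↥(maximalRealSubfield L)) L (IsCMField.complexConj L) 3 V.Hm a), 1)
            (piSchwartzBruhatEquiv (↥(maximalRealSubfield L)) (Fin 3) (Φarch ℓ ⊗ₜ[ℂ] Φf)) =
          piSchwartzBruhatEquiv (↥(maximalRealSubfield L)) (Fin 3) (Φarch ℓ ⊗ₜ[ℂ] Φf)) :
    ThetaDistDatum (archSideOfChar V c hGR hGR₀ hGR₁ hGR₂ hGR₃ η₀ η₁ η₂ η₃ hmaj hrat AC) hV 3 :=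
  thetaDistDatumThreeOfG V c _ hGR hGR₀ hGR₁ hGR₂ hGR₃ η₀ η₁ η₂ η₃ rfl hV rfl hη₃c Φarch harm hdef

end CharPin


section TwistedPin34

variable (η : CMAdelic (L : Type) (frameD V) × CMAdelic (L : Type) (dW c.D) →* ℂˣ)
  (hη : ∀ γU ∈ CMRat (L : Type) (frameD V), ∀ γ ∈ CMRat (L : Type) (dW c.D), η (γU, γ) = 1)
  (hηc : Continuous fun p => ((η p : ℂˣ) : ℂ))
  (ν : CMAdelic (L : Type) (frameD V) →* ℂˣ)
  (hν : ∀ γU ∈ CMRat (L : Type) (frameD V), ν γU = 1)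
  (hνc : Continuous fun v => ((ν v : ℂˣ) : ℂ))
  (ν' : CMAdelic (L : Type) (frameD V) →* ℂˣ)
  (hν' : ∀ γU ∈ CMRat (L : Type) (frameD V), ν' γU = 1)
  (hν'c : Continuous fun v => ((ν' v : ℂˣ) : ℂ))
  (AT' : ∀ k : Fin 4, ArchLineInput V (lineRepT' V c.D hGR hGR₀ hGR₁ hGR₂ hGR₃ η ν ν' k))

/-- **THE HONEST (J4) DATUM OF SLOT 0 AT THE R2 PIN `archSideOfT' … η ν ν' …`** (doubly twisted; the side of `SInstance.SROGT'C`, THE pin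
of record for the `hΘ` ∕ `hJ` discharge). -/
def thetaDistDatumZeroOfT' (Φarch : Module.Dual ℂ (Fin 2 → ℂ) →ₗ[ℂ] 𝓢((Fin 3 → mixedSpace (↥(maximalRealSubfield L))), ℂ))
    (harm : ∀ (u : ↥(stabilizer U21 x₀)) (ℓ : Module.Dual ℂ (Fin 2 → ℂ)),
      lineOmega_zero V c.D hGR hGR₀ hGR₁ (etaT₀ V c.D η ν) (u : U21) (Φarch ℓ) =
        Φarch ((BallForms.isPullbackCocycle_cotangentCocycle.weightOf x₀).dual u ℓ))
    (hdef : ∀ a : UnitaryGroup.arch (↥(maximalRealSubfield L)) L (IsCMField.complexConj L) 3 V.Hm,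
      UnitaryGroup.archAt (↥(maximalRealSubfield L)) L (IsCMField.complexConj L) 3 V.Hm (UnitaryGroup.cmPlace (L : Type) ι₁)
          (NumberField.complexConj_smul_infinitePlace (L : Type) _) (IsCMField.complexConj_ne_one (L : Type)) a = 1 →
      ∀ (ℓ : Module.Dual ℂ (Fin 2 → ℂ)) (Φf : FinSB (↥(maximalRealSubfield L)) (Fin 3)),
        lineRepOf V c.D hGR hGR₀ hGR₁ hGR₂ hGR₃ (etaT₀ V c.D η ν) (etaT₁ V c.D η ν) (etaT₂ V c.D η ν') (etaT₃ V c.D η ν') 0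
            (HodgeCM.Adelic.regimeEquiv L V.Hm hV
              (UnitaryGroup.archToAdelic (↥(maximalRealSubfield L)) L (IsCMField.complexConj L) 3 V.Hm a), 1)
            (piSchwartzBruhatEquiv (↥(maximalRealSubfield L)) (Fin 3) (Φarch ℓ ⊗ₜ[ℂ] Φf)) =
          piSchwartzBruhatEquiv (↥(maximalRealSubfield L)) (Fin 3) (Φarch ℓ ⊗ₜ[ℂ] Φf)) :
    ThetaDistDatum (archSideOfT' V c hGR hGR₀ hGR₁ hGR₂ hGR₃ η hη hηc ν hν hνc ν' hν' hν'c h₁W AT') hV 0 :=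
  thetaDistDatumZeroOfG V c _ hGR hGR₀ hGR₁ hGR₂ hGR₃ (etaT₀ V c.D η ν) (etaT₁ V c.D η ν) (etaT₂ V c.D η ν') (etaT₃ V c.D η ν') rfl h₁W
    hV rfl (continuous_etaT₀ V c.D η ν hηc hνc) Φarch harm hdef

/-- **slot 1 at the R2 pin.** -/
def thetaDistDatumOneOfT' (Φarch : Module.Dual ℂ (Fin 2 → ℂ) →ₗ[ℂ] 𝓢((Fin 3 → mixedSpace (↥(maximalRealSubfield L))), ℂ))
    (harm : ∀ (u : ↥(stabilizer U21 x₀)) (ℓ : Module.Dual ℂ (Fin 2 → ℂ)),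
      lineOmega_one V c.D hGR hGR₀ hGR₁ (etaT₁ V c.D η ν) (u : U21) (Φarch ℓ) =
        Φarch ((BallForms.isPullbackCocycle_cotangentCocycle.weightOf x₀).dual u ℓ))
    (hdef : ∀ a : UnitaryGroup.arch (↥(maximalRealSubfield L)) L (IsCMField.complexConj L) 3 V.Hm,
      UnitaryGroup.archAt (↥(maximalRealSubfield L)) L (IsCMField.complexConj L) 3 V.Hm (UnitaryGroup.cmPlace (L : Type) ι₁)
          (NumberField.complexConj_smul_infinitePlace (L : Type) _) (IsCMField.complexConj_ne_one (L : Type)) a = 1 →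
      ∀ (ℓ : Module.Dual ℂ (Fin 2 → ℂ)) (Φf : FinSB (↥(maximalRealSubfield L)) (Fin 3)),
        lineRepOf V c.D hGR hGR₀ hGR₁ hGR₂ hGR₃ (etaT₀ V c.D η ν) (etaT₁ V c.D η ν) (etaT₂ V c.D η ν') (etaT₃ V c.D η ν') 1
            (HodgeCM.Adelic.regimeEquiv L V.Hm hV
              (UnitaryGroup.archToAdelic (↥(maximalRealSubfield L)) L (IsCMField.complexConj L) 3 V.Hm a), 1)
            (piSchwartzBruhatEquiv (↥(maximalRealSubfield L)) (Fin 3) (Φarch ℓ ⊗ₜ[ℂ] Φf)) =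
          piSchwartzBruhatEquiv (↥(maximalRealSubfield L)) (Fin 3) (Φarch ℓ ⊗ₜ[ℂ] Φf)) :
    ThetaDistDatum (archSideOfT' V c hGR hGR₀ hGR₁ hGR₂ hGR₃ η hη hηc ν hν hνc ν' hν' hν'c h₁W AT') hV 1 :=
  thetaDistDatumOneOfG V c _ hGR hGR₀ hGR₁ hGR₂ hGR₃ (etaT₀ V c.D η ν) (etaT₁ V c.D η ν) (etaT₂ V c.D η ν') (etaT₃ V c.D η ν') rfl hV
    rfl (continuous_etaT₁ V c.D η ν hηc hνc) Φarch harm hdef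

/-- **slot 2 at the R2 pin** (twisted by `ν′`). -/
def thetaDistDatumTwoOfT' (Φarch : Module.Dual ℂ (Fin 2 → ℂ) →ₗ[ℂ] 𝓢((Fin 3 → mixedSpace (↥(maximalRealSubfield L))), ℂ))
    (harm : ∀ (u : ↥(stabilizer U21 x₀)) (ℓ : Module.Dual ℂ (Fin 2 → ℂ)),
      lineOmega_two V c.D hGR hGR₂ hGR₃ (etaT₂ V c.D η ν') (u : U21) (Φarch ℓ) =
        Φarch ((BallForms.isPullbackCocycle_cotangentCocycle.weightOf x₀).dual u ℓ))
    (hdef : ∀ a : UnitaryGroup.arch (↥(maximalRealSubfield L)) L (IsCMField.complexConj L) 3 V.Hm,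
      UnitaryGroup.archAt (↥(maximalRealSubfield L)) L (IsCMField.complexConj L) 3 V.Hm (UnitaryGroup.cmPlace (L : Type) ι₁)
          (NumberField.complexConj_smul_infinitePlace (L : Type) _) (IsCMField.complexConj_ne_one (L : Type)) a = 1 →
      ∀ (ℓ : Module.Dual ℂ (Fin 2 → ℂ)) (Φf : FinSB (↥(maximalRealSubfield L)) (Fin 3)),
        lineRepOf V c.D hGR hGR₀ hGR₁ hGR₂ hGR₃ (etaT₀ V c.D η ν) (etaT₁ V c.D η ν) (etaT₂ V c.D η ν') (etaT₃ V c.D η ν') 2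
            (HodgeCM.Adelic.regimeEquiv L V.Hm hV
              (UnitaryGroup.archToAdelic (↥(maximalRealSubfield L)) L (IsCMField.complexConj L) 3 V.Hm a), 1)
            (piSchwartzBruhatEquiv (↥(maximalRealSubfield L)) (Fin 3) (Φarch ℓ ⊗ₜ[ℂ] Φf)) =
          piSchwartzBruhatEquiv (↥(maximalRealSubfield L)) (Fin 3) (Φarch ℓ ⊗ₜ[ℂ] Φf)) :
    ThetaDistDatum (archSideOfT' V c hGR hGR₀ hGR₁ hGR₂ hGR₃ η hη hηc ν hν hνc ν' hν' hν'c h₁W AT') hV 2 :=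
  thetaDistDatumTwoOfG V c _ hGR hGR₀ hGR₁ hGR₂ hGR₃ (etaT₀ V c.D η ν) (etaT₁ V c.D η ν) (etaT₂ V c.D η ν') (etaT₃ V c.D η ν') rfl h₁W
    hV rfl (continuous_etaT₂ V c.D η ν' hηc hν'c) Φarch harm hdef

/-- **slot 3 at the R2 pin** (twisted by `ν′`). -/
def thetaDistDatumThreeOfT' (Φarch : Module.Dual ℂ (Fin 2 → ℂ) →ₗ[ℂ] 𝓢((Fin 3 → mixedSpace (↥(maximalRealSubfield L))), ℂ))
    (harm : ∀ (u : ↥(stabilizer U21 x₀)) (ℓ : Module.Dual ℂ (Fin 2 → ℂ)),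
      lineOmega_three V c.D hGR hGR₂ hGR₃ (etaT₃ V c.D η ν') (u : U21) (Φarch ℓ) =
        Φarch ((BallForms.isPullbackCocycle_cotangentCocycle.weightOf x₀).dual u ℓ))
    (hdef : ∀ a : UnitaryGroup.arch (↥(maximalRealSubfield L)) L (IsCMField.complexConj L) 3 V.Hm,
      UnitaryGroup.archAt (↥(maximalRealSubfield L)) L (IsCMField.complexConj L) 3 V.Hm (UnitaryGroup.cmPlace (L : Type) ι₁)
          (NumberField.complexConj_smul_infinitePlace (L : Type) _) (IsCMField.complexConj_ne_one (L : Type)) a = 1 →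
      ∀ (ℓ : Module.Dual ℂ (Fin 2 → ℂ)) (Φf : FinSB (↥(maximalRealSubfield L)) (Fin 3)),
        lineRepOf V c.D hGR hGR₀ hGR₁ hGR₂ hGR₃ (etaT₀ V c.D η ν) (etaT₁ V c.D η ν) (etaT₂ V c.D η ν') (etaT₃ V c.D η ν') 3
            (HodgeCM.Adelic.regimeEquiv L V.Hm hV
              (UnitaryGroup.archToAdelic (↥(maximalRealSubfield L)) L (IsCMField.complexConj L) 3 V.Hm a), 1)
            (piSchwartzBruhatEquiv (↥(maximalRealSubfield L)) (Fin 3) (Φarch ℓ ⊗ₜ[ℂ] Φf)) =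
          piSchwartzBruhatEquiv (↥(maximalRealSubfield L)) (Fin 3) (Φarch ℓ ⊗ₜ[ℂ] Φf)) :
    ThetaDistDatum (archSideOfT' V c hGR hGR₀ hGR₁ hGR₂ hGR₃ η hη hηc ν hν hνc ν' hν' hν'c h₁W AT') hV 3 :=
  thetaDistDatumThreeOfG V c _ hGR hGR₀ hGR₁ hGR₂ hGR₃ (etaT₀ V c.D η ν) (etaT₁ V c.D η ν) (etaT₂ V c.D η ν') (etaT₃ V c.D η ν') rfl hV
    rfl (continuous_etaT₃ V c.D η ν' hηc hν'c) Φarch harm hdef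

end TwistedPin34

end ThetaAdelicSide
end HodgeCM.Model

end
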